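import Mathlib
import Literature.NumberTheory.LFunctions.MertensFormula
import Summits.Parity.BatemanHorn.Theorems.IsogenyRedeiSplitBlockJacobiSplitMassBound
import HarnessLib

/-!
# Small-cofactor tail, II: Mertens windows for `∑ 1/(QQ′)` over the tail pairs
(stub `stub_smallCofactorTail`, helper 2/3, line `cofactor-root-discrepancy`,
crux `SplitBlockJacobi`, stmt-Parity-11583)

For `θ ∈ (1/2, 1)`, `0 ≤ μ ≤ 1/2` and any finite set `T` of prime pairs `(Q, Q′)` with
`x^θ < Q < Q′`, `x^{2−μ} < QQ′ ≤ x² + 1`, we prove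

  `∑_{(Q,Q′) ∈ T} 1/(QQ′) ≤ 4μ + 68/log x`

for `x ≥ 4`, `x^θ ≥ 2`, `log x ≥ 24` (`sum_inv_pairs_le`), hence eventually in `x`
(`eventually_sum_inv_tail_pairs_le`).

Proof. `Q ≤ x` (as `Q² < QQ′ ≤ x² + 1`), and for fixed `Q` the partner `Q′` lies in the window
`(x^{2−μ}/Q, (x²+1)/Q]`, whose lower end is `≥ x^{1−μ} ≥ x^{1/2} ≥ 2` and whose ratio is
`≤ 2x^μ`. Mertens' second theorem with rate (`abs_primeRecipSum_sub_le`,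
`|∑_{p ≤ y} 1/p − log log y − M| ≤ 8/log y`) gives for `2 ≤ a ≤ b`
`∑_{a < p ≤ b} 1/p ≤ log(b/a)/log a + 16/log a` (`sum_inv_primes_window_le`), here
`≤ (μ log x + log 2 + 16)/((1/2) log x) ≤ 2μ + 34/log x`; summing `1/Q` over the primes in
`(x^θ, x]` costs a factor `2(1 − θ) + 24/log x ≤ 2` (the tree's `sum_inv_primes_sdiff_le`).
-/

noncomputable section

open Filter Finset

namespace Summit.Parity.BatemanHorn.Cruxes.SplitBlockJacobi.CofactorRootDiscrepancy

open Literature.NumberTheory.LFunctions.Mertens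
open Summit.Parity.BatemanHorn.Cruxes.SplitBlockJacobi.SplitMassMiddlePrime

namespace SmallCofactor

/-- **Mertens window.** For `2 ≤ a ≤ b`:
`∑_{a < p ≤ b} 1/p ≤ (log b − log a)/log a + 16/log a`
(Mertens' second theorem with rate at `a` and at `b`, and `log(log b/log a) ≤ log b/log a − 1`). -/
theorem sum_inv_primes_window_le {a b : ℝ} (ha : 2 ≤ a) (hab : a ≤ b) :
    ∑ p ∈ Nat.primesLE ⌊b⌋₊ \ Nat.primesLE ⌊a⌋₊, (p : ℝ)⁻¹ ≤
      (Real.log b - Real.log a) / Real.log a + 16 / Real.log a := by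
  have hb : 2 ≤ b := ha.trans hab
  have hsub : Nat.primesLE ⌊a⌋₊ ⊆ Nat.primesLE ⌊b⌋₊ := Nat.primesLE_mono (Nat.floor_le_floor hab)
  rw [Finset.sum_sdiff_eq_sub hsub]
  change primeRecipSum b - primeRecipSum a ≤ _
  have h1 := (abs_le.mp (abs_primeRecipSum_sub_le hb)).2
  have h2 := (abs_le.mp (abs_primeRecipSum_sub_le ha)).1
  have hla : 0 < Real.log a := Real.log_pos (by linarith)
  have hlb : 0 < Real.log b := Real.log_pos (by linarith)
  have hlab : Real.log a ≤ Real.log b := Real.log_le_log (by linarith) hab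
  have h3 : 8 / Real.log b ≤ 8 / Real.log a := div_le_div_of_nonneg_left (by norm_num) hla hlab
  have h4 : Real.log (Real.log b) - Real.log (Real.log a) ≤
      (Real.log b - Real.log a) / Real.log a := by
    rw [← Real.log_div hlb.ne' hla.ne']
    have h5 := Real.log_le_sub_one_of_pos (div_pos hlb hla)
    have heq : Real.log b / Real.log a - 1 = (Real.log b - Real.log a) / Real.log a := by
      field_simp
    linarith
  have h16 : 8 / Real.log a + 8 / Real.log a = 16 / Real.log a := by ring
  linarith

/-- **The Mertens bound for the tail pairs.** For `1/2 < θ < 1`, `0 ≤ μ ≤ 1/2`, `x ≥ 4` with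
`x^θ ≥ 2` and `log x ≥ 24`, and any finite set `T` of prime pairs `(Q, Q′)` with `x^θ < Q < Q′`,
`QQ′ ≤ x² + 1`, `x^{2−μ} < QQ′`:  `∑_{T} 1/(QQ′) ≤ 4μ + 68/log x`. -/
theorem sum_inv_pairs_le {θ μ : ℝ} (hθ : 1 / 2 < θ) (hθ1 : θ < 1) (hμ0 : 0 ≤ μ) (hμ : μ ≤ 1 / 2)
    {x : ℕ} (hx : 4 ≤ x) (hxθ : 2 ≤ (x : ℝ) ^ θ) (hlog : 24 ≤ Real.log x)
    (T : Finset (ℕ × ℕ))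
    (hT : ∀ q ∈ T, q.1.Prime ∧ q.2.Prime ∧ (x : ℝ) ^ θ < (q.1 : ℝ) ∧ q.1 < q.2 ∧
      q.1 * q.2 ≤ x ^ 2 + 1 ∧ (x : ℝ) ^ (2 - μ) < ((q.1 * q.2 : ℕ) : ℝ)) :
    ∑ q ∈ T, (((q.1 * q.2 : ℕ) : ℝ))⁻¹ ≤ 4 * μ + 68 / Real.log x := by
  have hx1 : (1 : ℝ) < x := by exact_mod_cast lt_of_lt_of_le (by norm_num) hx
  have hx0 : (0 : ℝ) < x := by linarith
  have hlogx : 0 < Real.log x := by linarith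
  -- the outer prime set `(x^θ, x]` and the box of partners
  set P1 : Finset ℕ := Nat.primesLE x \ Nat.primesLE ⌊(x : ℝ) ^ θ⌋₊ with hP1
  set P2 : Finset ℕ := Nat.primesLE (x ^ 2 + 1) with hP2
  -- Step 1: `T` lies in the filtered box
  have hTU : T ⊆ (P1 ×ˢ P2).filter (fun q : ℕ × ℕ =>
      (x : ℝ) ^ (2 - μ) < ((q.1 * q.2 : ℕ) : ℝ) ∧ q.1 * q.2 ≤ x ^ 2 + 1) := by
    intro q hq
    obtain ⟨hq1, hq2, hθq, hlt, hle, hbig⟩ := hT q hq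
    rw [Finset.mem_filter, Finset.mem_product]
    refine ⟨⟨?_, ?_⟩, hbig, hle⟩
    · rw [hP1, Finset.mem_sdiff, Nat.mem_primesLE, Nat.mem_primesLE]
      refine ⟨⟨?_, hq1⟩, fun h => ?_⟩
      · by_contra hcon
        push Not at hcon
        have h1 : x + 1 ≤ q.1 := hcon
        have h2 : x + 2 ≤ q.2 := by omega
        have h3 : (x + 1) * (x + 2) ≤ q.1 * q.2 := Nat.mul_le_mul h1 h2
        nlinarith
      · have : ⌊(x : ℝ) ^ θ⌋₊ < q.1 := (Nat.floor_lt (by positivity)).mpr hθq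
        omega
    · rw [hP2, Nat.mem_primesLE]
      exact ⟨le_trans (Nat.le_mul_of_pos_left _ hq1.pos) hle, hq2⟩
  -- Step 2: Fubini over the box
  have hU : ∑ q ∈ (P1 ×ˢ P2).filter (fun q : ℕ × ℕ =>
        (x : ℝ) ^ (2 - μ) < ((q.1 * q.2 : ℕ) : ℝ) ∧ q.1 * q.2 ≤ x ^ 2 + 1),
        (((q.1 * q.2 : ℕ) : ℝ))⁻¹ =
      ∑ Q ∈ P1, ∑ Q' ∈ P2.filter (fun Q' : ℕ =>
        (x : ℝ) ^ (2 - μ) < ((Q * Q' : ℕ) : ℝ) ∧ Q * Q' ≤ x ^ 2 + 1), (((Q * Q' : ℕ) : ℝ))⁻¹ := by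
    rw [Finset.sum_filter, Finset.sum_product]
    refine Finset.sum_congr rfl fun Q _ => ?_
    rw [Finset.sum_filter]
  -- Step 3: the inner window bound
  have hinner : ∀ Q ∈ P1, ∑ Q' ∈ P2.filter (fun Q' : ℕ =>
      (x : ℝ) ^ (2 - μ) < ((Q * Q' : ℕ) : ℝ) ∧ Q * Q' ≤ x ^ 2 + 1), (((Q * Q' : ℕ) : ℝ))⁻¹ ≤
        (Q : ℝ)⁻¹ * (2 * μ + 34 / Real.log x) := by
    intro Q hQ
    rw [hP1, Finset.mem_sdiff, Nat.mem_primesLE, Nat.mem_primesLE] at hQ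
    obtain ⟨⟨hQx, hQp⟩, -⟩ := hQ
    have hQ0 : (0 : ℝ) < Q := by exact_mod_cast hQp.pos
    have hQx' : (Q : ℝ) ≤ x := by exact_mod_cast hQx
    -- the window `(a, b]`
    set a : ℝ := (x : ℝ) ^ (2 - μ) / Q with ha
    set b : ℝ := ((x : ℝ) ^ 2 + 1) / Q with hb
    have hxpow : (x : ℝ) ^ (2 - μ) = (x : ℝ) ^ (1 - μ) * x := by
      rw [show (2 : ℝ) - μ = (1 - μ) + 1 by ring, Real.rpow_add hx0, Real.rpow_one]
    have ha2 : 2 ≤ a := by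
      have h1 : (x : ℝ) ^ (1 / 2 : ℝ) ≤ (x : ℝ) ^ (1 - μ) :=
        Real.rpow_le_rpow_of_exponent_le hx1.le (by linarith)
      have h2 : (2 : ℝ) ≤ (x : ℝ) ^ (1 / 2 : ℝ) := by
        have h4 : (4 : ℝ) ≤ x := by exact_mod_cast hx
        calc (2 : ℝ) = (4 : ℝ) ^ (1 / 2 : ℝ) := by
              rw [show (4 : ℝ) = 2 ^ 2 by norm_num, ← Real.rpow_natCast,
                ← Real.rpow_mul (by norm_num)]
              norm_num
          _ ≤ (x : ℝ) ^ (1 / 2 : ℝ) := Real.rpow_le_rpow (by norm_num) h4 (by norm_num)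
      have h3 : (x : ℝ) ^ (1 - μ) ≤ a := by
        rw [ha, le_div_iff₀ hQ0, hxpow]
        exact mul_le_mul_of_nonneg_left hQx' (by positivity)
      linarith
    have hab : a ≤ b := by
      rw [ha, hb]
      refine div_le_div_of_nonneg_right ?_ hQ0.le
      calc (x : ℝ) ^ (2 - μ) ≤ (x : ℝ) ^ (2 : ℝ) :=
            Real.rpow_le_rpow_of_exponent_le hx1.le (by linarith)
        _ = (x : ℝ) ^ 2 := Real.rpow_two _
        _ ≤ (x : ℝ) ^ 2 + 1 := by linarith
    -- the fibre lies in the window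
    have hsub : P2.filter (fun Q' : ℕ =>
        (x : ℝ) ^ (2 - μ) < ((Q * Q' : ℕ) : ℝ) ∧ Q * Q' ≤ x ^ 2 + 1) ⊆
          Nat.primesLE ⌊b⌋₊ \ Nat.primesLE ⌊a⌋₊ := by
      intro Q' hQ'
      rw [Finset.mem_filter, hP2, Nat.mem_primesLE] at hQ'
      obtain ⟨⟨-, hQ'p⟩, hbig, hle⟩ := hQ'
      rw [Finset.mem_sdiff, Nat.mem_primesLE, Nat.mem_primesLE]
      refine ⟨⟨Nat.le_floor ?_, hQ'p⟩, fun h => ?_⟩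
      · rw [hb, le_div_iff₀ hQ0]
        have h1 : ((Q * Q' : ℕ) : ℝ) ≤ ((x ^ 2 + 1 : ℕ) : ℝ) := by exact_mod_cast hle
        push_cast at h1
        linarith [mul_comm (Q : ℝ) Q']
      · have h1 : a < Q' := by
          rw [ha, div_lt_iff₀ hQ0]
          push_cast at hbig
          linarith [mul_comm (Q : ℝ) Q']
        have h2 : (Q' : ℝ) ≤ ⌊a⌋₊ := by exact_mod_cast h.1
        have h3 : (⌊a⌋₊ : ℝ) ≤ a := Nat.floor_le (by positivity)
        linarith
    -- Mertens over the window and the size of its ends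
    have hwin := sum_inv_primes_window_le ha2 hab
    have hla : 1 / 2 * Real.log x ≤ Real.log a := by
      rw [ha, Real.log_div (by positivity) hQ0.ne', Real.log_rpow hx0]
      have h1 : Real.log Q ≤ Real.log x := Real.log_le_log hQ0 hQx'
      have h2 : 0 ≤ (1 / 2 - μ) * Real.log x := mul_nonneg (by linarith) hlogx.le
      nlinarith
    have hla0 : 0 < Real.log a := by linarith
    have hnum : Real.log b - Real.log a ≤ Real.log 2 + μ * Real.log x := by
      rw [hb, ha, Real.log_div (by positivity) hQ0.ne', Real.log_div (by positivity) hQ0.ne',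
        Real.log_rpow hx0]
      have h1 : Real.log ((x : ℝ) ^ 2 + 1) ≤ Real.log (2 * (x : ℝ) ^ 2) :=
        Real.log_le_log (by positivity) (by nlinarith)
      rw [Real.log_mul two_ne_zero (by positivity), Real.log_pow] at h1
      push_cast at h1
      linarith
    have hlog2 : Real.log 2 < 1 := by
      have := Real.log_two_lt_d9
      linarith
    calc ∑ Q' ∈ P2.filter (fun Q' : ℕ =>
          (x : ℝ) ^ (2 - μ) < ((Q * Q' : ℕ) : ℝ) ∧ Q * Q' ≤ x ^ 2 + 1), (((Q * Q' : ℕ) : ℝ))⁻¹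
        ≤ ∑ Q' ∈ Nat.primesLE ⌊b⌋₊ \ Nat.primesLE ⌊a⌋₊, (((Q * Q' : ℕ) : ℝ))⁻¹ :=
          Finset.sum_le_sum_of_subset_of_nonneg hsub fun _ _ _ => by positivity
      _ = (Q : ℝ)⁻¹ * ∑ Q' ∈ Nat.primesLE ⌊b⌋₊ \ Nat.primesLE ⌊a⌋₊, (Q' : ℝ)⁻¹ := by
          rw [Finset.mul_sum]
          refine Finset.sum_congr rfl fun Q' _ => ?_
          push_cast
          rw [mul_inv]
      _ ≤ (Q : ℝ)⁻¹ * ((Real.log b - Real.log a) / Real.log a + 16 / Real.log a) :=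
          mul_le_mul_of_nonneg_left hwin (by positivity)
      _ ≤ (Q : ℝ)⁻¹ * (2 * μ + 34 / Real.log x) := by
          refine mul_le_mul_of_nonneg_left ?_ (by positivity)
          rw [← add_div, div_le_iff₀ hla0]
          have h1 : (2 * μ + 34 / Real.log x) * (1 / 2 * Real.log x) ≤
              (2 * μ + 34 / Real.log x) * Real.log a :=
            mul_le_mul_of_nonneg_left hla (by positivity)
          have h2 : (2 * μ + 34 / Real.log x) * (1 / 2 * Real.log x) = μ * Real.log x + 17 := by
            field_simp
            ring
          linarith
  -- Step 4: assemble with the outer Mertens sum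
  have houter := sum_inv_primes_sdiff_le hθ hθ1 hxθ
  have h24 : 24 / Real.log x ≤ 1 := by rwa [div_le_one hlogx]
  have hB0 : 0 ≤ 2 * μ + 34 / Real.log x := by positivity
  calc ∑ q ∈ T, (((q.1 * q.2 : ℕ) : ℝ))⁻¹
      ≤ ∑ q ∈ (P1 ×ˢ P2).filter (fun q : ℕ × ℕ =>
          (x : ℝ) ^ (2 - μ) < ((q.1 * q.2 : ℕ) : ℝ) ∧ q.1 * q.2 ≤ x ^ 2 + 1),
          (((q.1 * q.2 : ℕ) : ℝ))⁻¹ :=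
        Finset.sum_le_sum_of_subset_of_nonneg hTU fun _ _ _ => by positivity
    _ = ∑ Q ∈ P1, ∑ Q' ∈ P2.filter (fun Q' : ℕ =>
          (x : ℝ) ^ (2 - μ) < ((Q * Q' : ℕ) : ℝ) ∧ Q * Q' ≤ x ^ 2 + 1),
          (((Q * Q' : ℕ) : ℝ))⁻¹ := hU
    _ ≤ ∑ Q ∈ P1, (Q : ℝ)⁻¹ * (2 * μ + 34 / Real.log x) := Finset.sum_le_sum hinner
    _ = (∑ Q ∈ P1, (Q : ℝ)⁻¹) * (2 * μ + 34 / Real.log x) := by rw [Finset.sum_mul]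
    _ ≤ (2 * (1 - θ) + 24 / Real.log x) * (2 * μ + 34 / Real.log x) :=
        mul_le_mul_of_nonneg_right houter hB0
    _ ≤ 2 * (2 * μ + 34 / Real.log x) := mul_le_mul_of_nonneg_right (by linarith) hB0
    _ = 4 * μ + 68 / Real.log x := by ring

end SmallCofactor

/-- **Eventual form (registered sub-goal of `stub_smallCofactorTail`).** For `1/2 < θ < 1` and
`0 ≤ μ ≤ 1/2`, eventually in `x`: every finite set `T` of prime pairs `(Q, Q′)` with
`x^θ < Q < Q′`, `QQ′ ≤ x² + 1`, `x^{2−μ} < QQ′` has `∑_{T} 1/(QQ′) ≤ 4μ + 68/log x`. -/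
theorem eventually_sum_inv_tail_pairs_le :
    ∀ θ μ : ℝ, 1 / 2 < θ → θ < 1 → 0 ≤ μ → μ ≤ 1 / 2 →
      ∀ᶠ x : ℕ in Filter.atTop, ∀ T : Finset (ℕ × ℕ),
        (∀ q ∈ T, q.1.Prime ∧ q.2.Prime ∧ (x : ℝ) ^ θ < (q.1 : ℝ) ∧ q.1 < q.2 ∧
          q.1 * q.2 ≤ x ^ 2 + 1 ∧ (x : ℝ) ^ (2 - μ) < ((q.1 * q.2 : ℕ) : ℝ)) →
        ∑ q ∈ T, (((q.1 * q.2 : ℕ) : ℝ))⁻¹ ≤ 4 * μ + 68 / Real.log x := by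
  intro θ μ hθ hθ1 hμ0 hμ
  have hθ0 : 0 < θ := by linarith
  have ev1 : ∀ᶠ x : ℕ in atTop, 4 ≤ x := eventually_ge_atTop 4
  have ev2 : ∀ᶠ x : ℕ in atTop, 2 ≤ (x : ℝ) ^ θ :=
    ((tendsto_rpow_atTop hθ0).comp tendsto_natCast_atTop_atTop).eventually_ge_atTop 2
  have ev3 : ∀ᶠ x : ℕ in atTop, 24 ≤ Real.log x :=
    (Real.tendsto_log_atTop.comp tendsto_natCast_atTop_atTop).eventually_ge_atTop _
  filter_upwards [ev1, ev2, ev3] with x h1 h2 h3 T hT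
  exact SmallCofactor.sum_inv_pairs_le hθ hθ1 hμ0 hμ h1 h2 h3 T hT

end Summit.Parity.BatemanHorn.Cruxes.SplitBlockJacobi.CofactorRootDiscrepancy

end
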